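import Summits.AtomisticToContinuum.BoseEinsteinCondensation.Theorems.BECThomsonPrincipleFibreConductanceFlatteningDefs
import HarnessLib

/-!
# Route `BECThomsonPrinciple`, crux `FibreConductance` (stmt-AtomisticToContinuum-9480),
# line `parseval-shell-bootstrap` (r4) — stub `stub_flatFlowCost`: CUBED FIBRE COST OF THE
# FLATTENING FLOW

`stub_flatFlowCost : Goal.stub_flatFlowCost` (`= FlatFlowCost` of
`Theorems/BECThomsonPrincipleFibreConductanceFlatteningDefs.lean`): for `L > 0`, a zero-free state
`Φ` and a configuration `X`, the fibre cost `D(X̂) = ∫_cell |J|²/ψ² dy` of the iterated-primitive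
flattening flow `J = flatFlow L Φ` satisfies `D³ ≤ 576 L³ ∫_cell (Σᵢ ⟨g⟩ᵢ⁶)·g⁻³ dy`
(`lineMomentIntegrand`), pointwise in the bath.

* `cost_cube_le` — the pointwise real inequality: `|J₀| ≤ 2L·L⁻³·A₃`, `|J₁| ≤ 2L·L⁻³·A₂`,
  `|J₂| ≤ 2L·L⁻³·A₁` and `g = L³ψ²` give `((J₀² + J₁² + J₂²)/ψ²)³ ≤ 576 L⁻³ (Σᵢ Aᵢ⁶) g⁻³`
  (power mean `(a + b + c)³ ≤ 9 (a³ + b³ + c³)`);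
* `lintegral_pow_three_le_mul` — Jensen / Hölder `(3, 3/2)` against the constant `1` on a finite
  measure space: `(∫ u)³ ≤ μ(univ)² ∫ u³` (`ENNReal.lintegral_mul_le_Lp_mul_Lq`);
* `sum_norm_sq_flatFlow` — `Σ_l ‖J_l‖² = J₀² + J₁² + J₂²` for the three real components;
* `fibreDensCost_flatFlow_pow_three_le` — the assembly on the cell `[0,L)³` (where
  `0 ≤ y_l ≤ L`, so `abs_linePrim_fluct_le` applies to each component), `|cell| = L³`
  (`volume_cell`), and `L⁶ · 576 L⁻³ = 576 L³`.

All [folklore] (Hölder's inequality and one-variable calculus; G. B. Folland, *Real Analysis*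
(1999), Thm. 6.2, §2.5–2.6).
-/

noncomputable section

namespace Summit.AtomisticToContinuum.BoseEinsteinCondensation.Cruxes.FibreConductance.ParsevalShellBootstrap

open MeasureTheory
open scoped ENNReal
open Literature.MathematicalPhysics.QuantumManyBody.BoseGas
open Summit.AtomisticToContinuum.BoseEinsteinCondensation.Cruxes.FibreConductance.TaggedPathHarnack

variable {m : ℕ} {L : ℝ}

/-! ### Real arithmetic: the pointwise bound -/

/-- **The pointwise bound on the cubed cost integrand.** If the three components of a flow satisfy
`|J₀| ≤ 2L⁻³L·A₃`, `|J₁| ≤ 2L⁻³L·A₂`, `|J₂| ≤ 2L⁻³L·A₁`, and `g = L³ψ²` with `ψ > 0`,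
then `((J₀² + J₁² + J₂²)/ψ²)³ ≤ 576 L⁻³ · (A₁⁶ + A₂⁶ + A₃⁶) · (g⁻¹)³`
(`Σ Jᵢ² ≤ 4L⁻⁴ Σ Aᵢ²`, `1/ψ² = L³/g`, and `(Σ Aᵢ²)³ ≤ 9 Σ Aᵢ⁶`). [folklore] -/
theorem cost_cube_le {L ψ g J₀ J₁ J₂ A₁ A₂ A₃ : ℝ} (hL : 0 < L) (hψ : 0 < ψ)
    (hg : g = L ^ 3 * ψ ^ 2) (h₀ : |J₀| ≤ 2 * (L ^ 3)⁻¹ * L * A₃)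
    (h₁ : |J₁| ≤ 2 * (L ^ 3)⁻¹ * L * A₂) (h₂ : |J₂| ≤ 2 * (L ^ 3)⁻¹ * L * A₁) :
    ((J₀ ^ 2 + J₁ ^ 2 + J₂ ^ 2) / ψ ^ 2) ^ 3 ≤
      576 * (L ^ 3)⁻¹ * ((A₁ ^ 6 + A₂ ^ 6 + A₃ ^ 6) * (g⁻¹) ^ 3) := by
  subst hg
  have hL0 : L ≠ 0 := hL.ne'
  have hψ0 : ψ ≠ 0 := hψ.ne'
  set κ : ℝ := 2 * (L ^ 3)⁻¹ * L with hκ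
  have hsq : ∀ {J A : ℝ}, |J| ≤ κ * A → J ^ 2 ≤ κ ^ 2 * A ^ 2 := by
    intro J A h
    calc J ^ 2 = |J| ^ 2 := (sq_abs J).symm
      _ ≤ (κ * A) ^ 2 := pow_le_pow_left₀ (abs_nonneg J) h 2
      _ = κ ^ 2 * A ^ 2 := mul_pow κ A 2
  set S : ℝ := A₁ ^ 2 + A₂ ^ 2 + A₃ ^ 2 with hS
  have hsum : J₀ ^ 2 + J₁ ^ 2 + J₂ ^ 2 ≤ κ ^ 2 * S := by
    have e₀ := hsq h₀
    have e₁ := hsq h₁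
    have e₂ := hsq h₂
    rw [hS]
    linarith
  have hψ2 : 0 < ψ ^ 2 := by positivity
  have hF0 : 0 ≤ (J₀ ^ 2 + J₁ ^ 2 + J₂ ^ 2) / ψ ^ 2 := by positivity
  have hF : (J₀ ^ 2 + J₁ ^ 2 + J₂ ^ 2) / ψ ^ 2 ≤ κ ^ 2 * S / ψ ^ 2 :=
    div_le_div_of_nonneg_right hsum hψ2.le
  -- power mean `(a + b + c)³ ≤ 9 (a³ + b³ + c³)` for `a, b, c ≥ 0`
  -- (`a³ + b³ ≥ a²b + ab²` for each pair and `a³ + b³ + c³ ≥ 3abc`), at `a, b, c = A₁², A₂², A₃²`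
  have hcube : S ^ 3 ≤ 9 * ((A₁ ^ 2) ^ 3 + (A₂ ^ 2) ^ 3 + (A₃ ^ 2) ^ 3) := by
    have ha : 0 ≤ A₁ ^ 2 := sq_nonneg _
    have hb : 0 ≤ A₂ ^ 2 := sq_nonneg _
    have hc : 0 ≤ A₃ ^ 2 := sq_nonneg _
    rw [hS]
    nlinarith [mul_nonneg (add_nonneg ha hb) (sq_nonneg (A₁ ^ 2 - A₂ ^ 2)),
      mul_nonneg (add_nonneg hb hc) (sq_nonneg (A₂ ^ 2 - A₃ ^ 2)),
      mul_nonneg (add_nonneg ha hc) (sq_nonneg (A₁ ^ 2 - A₃ ^ 2)),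
      mul_nonneg (add_nonneg (add_nonneg ha hb) hc)
        (add_nonneg (add_nonneg (sq_nonneg (A₁ ^ 2 - A₂ ^ 2)) (sq_nonneg (A₂ ^ 2 - A₃ ^ 2)))
          (sq_nonneg (A₁ ^ 2 - A₃ ^ 2)))]
  have hK0 : 0 ≤ (κ ^ 2 / ψ ^ 2) ^ 3 := by positivity
  calc ((J₀ ^ 2 + J₁ ^ 2 + J₂ ^ 2) / ψ ^ 2) ^ 3 ≤ (κ ^ 2 * S / ψ ^ 2) ^ 3 :=
        pow_le_pow_left₀ hF0 hF 3
    _ = (κ ^ 2 / ψ ^ 2) ^ 3 * S ^ 3 := by ring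
    _ ≤ (κ ^ 2 / ψ ^ 2) ^ 3 * (9 * ((A₁ ^ 2) ^ 3 + (A₂ ^ 2) ^ 3 + (A₃ ^ 2) ^ 3)) :=
        mul_le_mul_of_nonneg_left hcube hK0
    _ = 576 * (L ^ 3)⁻¹ * ((A₁ ^ 6 + A₂ ^ 6 + A₃ ^ 6) * ((L ^ 3 * ψ ^ 2)⁻¹) ^ 3) := by
        rw [hκ]
        field_simp
        ring

/-! ### Hölder on a finite measure space -/

/-- **Jensen for the cube** on a finite measure space: `(∫ u dμ)³ ≤ μ(univ)² ∫ u³ dμ` (Hölder with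
exponents `(3, 3/2)` against the constant function `1`; Folland, *Real Analysis*, Thm. 6.2).
[folklore] -/
theorem lintegral_pow_three_le_mul {α : Type*} [MeasurableSpace α] (μ : Measure α)
    {u : α → ℝ≥0∞} (hu : AEMeasurable u μ) :
    (∫⁻ x, u x ∂μ) ^ 3 ≤ μ Set.univ ^ 2 * ∫⁻ x, u x ^ 3 ∂μ := by
  have hpq : (3 : ℝ).HolderConjugate (3 / 2) :=
    Real.holderConjugate_iff.2 ⟨by norm_num, by norm_num⟩
  have key := ENNReal.lintegral_mul_le_Lp_mul_Lq μ hpq hu (g := fun _ => 1) aemeasurable_const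
  have e3 : ∀ x, u x ^ (3 : ℝ) = u x ^ (3 : ℕ) := fun x => by
    rw [show (3 : ℝ) = ((3 : ℕ) : ℝ) by norm_num, ENNReal.rpow_natCast]
  simp only [Pi.mul_apply, mul_one, ENNReal.one_rpow, lintegral_const, one_mul, e3] at key
  calc (∫⁻ x, u x ∂μ) ^ 3
      ≤ ((∫⁻ x, u x ^ 3 ∂μ) ^ (1 / 3 : ℝ) * μ Set.univ ^ (1 / (3 / 2) : ℝ)) ^ 3 :=
        pow_le_pow_left' key 3
    _ = μ Set.univ ^ 2 * ∫⁻ x, u x ^ 3 ∂μ := by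
        rw [mul_pow, ← ENNReal.rpow_natCast, ← ENNReal.rpow_natCast, ← ENNReal.rpow_mul,
          ← ENNReal.rpow_mul, mul_comm]
        norm_num

/-! ### The components of the flattening flow -/

/-- `Σ_l ‖J_l‖² = J₀² + J₁² + J₂²` for the three real components of `flatFlow`
(`‖(r : ℂ)‖ = |r|`). [folklore] -/
theorem sum_norm_sq_flatFlow (L : ℝ) (Φ : PeriodicTrialState (m + 1) L) (Y : Config (m + 1)) :
    ∑ l : Fin 3, ‖flatFlow L Φ Y l‖ ^ 2 =
      linePrim 0 (fluct (L ^ 3)⁻¹ L 0 (gAvg2 L Φ)) Y ^ 2 +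
        linePrim 1 (fluct (L ^ 3)⁻¹ L 1 (gAvg1 L Φ)) Y ^ 2 +
          linePrim 2 (fluct (L ^ 3)⁻¹ L 2 (gDens L Φ)) Y ^ 2 := by
  obtain ⟨h0, h1, h2⟩ := flatFlow_apply L Φ Y
  rw [Fin.sum_univ_three, h0, h1, h2, Complex.norm_real, Complex.norm_real, Complex.norm_real,
    Real.norm_eq_abs, Real.norm_eq_abs, Real.norm_eq_abs, sq_abs, sq_abs, sq_abs]

/-! ### The cubed fibre cost -/

/-- **Cubed fibre cost of the flattening flow.** For `L > 0`, a zero-free state and any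
configuration `X`, `D(X̂)³ ≤ 576 L³ ∫_cell (Σᵢ⟨g⟩ᵢ⁶)·g⁻³ dy` where
`D(X̂) = fibreDensCost Φ (flatFlow L Φ) X`: on the cell `0 ≤ y_l < L`, so each component is bounded
by `abs_linePrim_fluct_le` (`|J₀| ≤ 2L⁻²⟨⟨⟨g⟩⟩⟩`, `|J₁| ≤ 2L⁻²⟨⟨g⟩⟩`, `|J₂| ≤ 2L⁻²⟨g⟩`), the cube
of the cell integral is bounded by `|cell|² = L⁶` times the integral of the cube (Hölder), and the
cubed integrand by `576 L⁻³ · lineMomentIntegrand` (`cost_cube_le`). [folklore] -/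
theorem fibreDensCost_flatFlow_pow_three_le (hL : 0 < L) (Φ : PeriodicTrialState (m + 1) L)
    (hΦ : ∀ X, Φ.ψ X ≠ 0) (X : Config (m + 1)) :
    fibreDensCost Φ (flatFlow L Φ) X ^ 3 ≤
      ENNReal.ofReal (576 * L ^ 3) *
        ∫⁻ y in cell L, ENNReal.ofReal (lineMomentIntegrand L Φ (Function.update X 0 y)) := by
  -- the cost integrand on the fibre
  set F : Space → ℝ := fun y =>
    (∑ l : Fin 3, ‖flatFlow L Φ (Function.update X 0 y) l‖ ^ 2) /
      fibrePsi Φ (Function.update X 0 y) ^ 2 with hF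
  have hupd : Continuous fun y : Space => Function.update X 0 y :=
    continuous_const.update 0 continuous_id
  have hJ : Continuous fun y : Space => flatFlow L Φ (Function.update X 0 y) :=
    (continuous_flatFlow hL Φ hΦ).comp hupd
  have hFc : Continuous F := by
    refine Continuous.div (continuous_finsetSum _ fun l _ => ?_)
      (((continuous_fibrePsi hL Φ hΦ).comp hupd).pow 2)
      fun y => pow_ne_zero _ (fibrePsi_pos hL Φ hΦ _).ne'
    exact ((continuous_apply l).comp hJ).norm.pow 2
  have hFm : AEMeasurable (fun y => ENNReal.ofReal (F y)) (volume.restrict (cell L)) :=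
    (ENNReal.measurable_ofReal.comp hFc.measurable).aemeasurable
  have hF0 : ∀ y, 0 ≤ F y := fun y => by
    rw [hF]
    positivity
  -- the pointwise bound on the cell
  have hpt : ∀ y ∈ cell L, ENNReal.ofReal (F y) ^ 3 ≤
      ENNReal.ofReal (576 * (L ^ 3)⁻¹) *
        ENNReal.ofReal (lineMomentIntegrand L Φ (Function.update X 0 y)) := by
    intro y hy
    rw [← ENNReal.ofReal_pow (hF0 y), ← ENNReal.ofReal_mul (by positivity)]
    refine ENNReal.ofReal_le_ofReal ?_
    set Y : Config (m + 1) := Function.update X 0 y with hY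
    have hY0 : Y 0 = y := by rw [hY, Function.update_self]
    have hc : (0 : ℝ) ≤ (L ^ 3)⁻¹ := by positivity
    have hy0 : ∀ l : Fin 3, 0 ≤ Y 0 l := fun l => by
      rw [hY0]
      exact (hy l).1
    have hy1 : ∀ l : Fin 3, Y 0 l ≤ L := fun l => by
      rw [hY0]
      exact (hy l).2.le
    -- `g = L³ψ² ≥ 0`, hence its iterated line averages are `≥ 0` (`lineAvg_nonneg`)
    have hg0 : ∀ Z, 0 ≤ gDens L Φ Z := fun Z => mul_nonneg (pow_nonneg hL.le 3) (sq_nonneg _)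
    have hg1 : ∀ Z, 0 ≤ gAvg1 L Φ Z := lineAvg_nonneg hL.le 2 hg0
    have hg2 : ∀ Z, 0 ≤ gAvg2 L Φ Z := lineAvg_nonneg hL.le 1 hg1
    have h₀ : |linePrim 0 (fluct (L ^ 3)⁻¹ L 0 (gAvg2 L Φ)) Y| ≤ 2 * (L ^ 3)⁻¹ * L * gAvg3 L Φ Y :=
      abs_linePrim_fluct_le hL hc 0 (contDiff_gAvg2 hL Φ hΦ).continuous hg2 (hy0 0) (hy1 0)
    have h₁ : |linePrim 1 (fluct (L ^ 3)⁻¹ L 1 (gAvg1 L Φ)) Y| ≤ 2 * (L ^ 3)⁻¹ * L * gAvg2 L Φ Y :=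
      abs_linePrim_fluct_le hL hc 1 (contDiff_gAvg1 hL Φ hΦ).continuous hg1 (hy0 1) (hy1 1)
    have h₂ : |linePrim 2 (fluct (L ^ 3)⁻¹ L 2 (gDens L Φ)) Y| ≤ 2 * (L ^ 3)⁻¹ * L * gAvg1 L Φ Y :=
      abs_linePrim_fluct_le hL hc 2 (contDiff_gDens hL Φ hΦ).continuous hg0 (hy0 2) (hy1 2)
    have key := cost_cube_le hL (fibrePsi_pos hL Φ hΦ Y)
      (rfl : gDens L Φ Y = L ^ 3 * fibrePsi Φ Y ^ 2) h₀ h₁ h₂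
    have hFY : F y = (∑ l : Fin 3, ‖flatFlow L Φ Y l‖ ^ 2) / fibrePsi Φ Y ^ 2 := by rw [hF]
    rw [hFY, sum_norm_sq_flatFlow]
    exact key
  -- Hölder on the cell and assembly
  have hD : fibreDensCost Φ (flatFlow L Φ) X = ∫⁻ y in cell L, ENNReal.ofReal (F y) := by
    rw [hF]
    rfl
  calc fibreDensCost Φ (flatFlow L Φ) X ^ 3
      ≤ (volume.restrict (cell L)) Set.univ ^ 2 * ∫⁻ y in cell L, ENNReal.ofReal (F y) ^ 3 := by
        rw [hD]
        exact lintegral_pow_three_le_mul _ hFm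
    _ ≤ (ENNReal.ofReal L ^ 3) ^ 2 * ∫⁻ y in cell L, ENNReal.ofReal (576 * (L ^ 3)⁻¹) *
          ENNReal.ofReal (lineMomentIntegrand L Φ (Function.update X 0 y)) := by
        rw [Measure.restrict_apply_univ, volume_cell]
        exact mul_le_mul_right (setLIntegral_mono' (measurableSet_cell L) hpt) _
    _ = ENNReal.ofReal (576 * L ^ 3) *
          ∫⁻ y in cell L, ENNReal.ofReal (lineMomentIntegrand L Φ (Function.update X 0 y)) := by
        rw [lintegral_const_mul' _ _ ENNReal.ofReal_ne_top, ← mul_assoc, ← ENNReal.ofReal_pow hL.le,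
          ← ENNReal.ofReal_pow (by positivity), ← ENNReal.ofReal_mul (by positivity)]
        congr 2
        field_simp

/-! ### The registered stub -/

/-- **Registered stub `stub_flatFlowCost`** of the line `parseval-shell-bootstrap` (r4): the cubed
fibre cost of the flattening flow is bounded pointwise in the bath by
`576 L³ ∫_cell lineMomentIntegrand` (statement `Goal.stub_flatFlowCost = FlatFlowCost`).
[folklore] -/
theorem stub_flatFlowCost : Goal.stub_flatFlowCost :=
  fun _m _L hL Φ hΦ X _hX => fibreDensCost_flatFlow_pow_three_le hL Φ hΦ X

end Summit.AtomisticToContinuum.BoseEinsteinCondensation.Cruxes.FibreConductance.ParsevalShellBootstrap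

end
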